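import Summits.BirchSwinnertonDyer.BirchSwinnertonDyer.Theses.KatoDescentTamePotSupersingular
import Summits.BirchSwinnertonDyer.BirchSwinnertonDyer.Theorems.KatoDescentTamePotSupersingularDefs
import Literature.NumberTheory.EllipticCurves.GaloisActionProofs
import Literature.NumberTheory.EllipticCurves.TorsionCardinality
import HarnessLib

/-!
# Route `KatoDescentTamePotSupersingular` (rung K8, sub-rung B4 (t′), cell `bsd-potss`): a locally
# IRREDUCIBLE `W[p]` passes Fouquet's Assumption 2.9 (2) in its exact form — `LocIrr W p → FouquetGenericAt p W`
# — UNCONDITIONALLY (a `--supports … --as helper` file for item stmt-BirchSwinnertonDyer-19981; seat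
# bsd-potss-k8t-c2, generation 4)

`Theorems.FouquetGenericAt p W` (route Defs §3, p436983) is Fouquet 2025's Ass. 2.9 (2) at `(W, p)` in its
exact census form: the `p`-division polynomial `ΨSq_p` of `W/ℚ_p` has no root in `ℚ_p`. The memo
`HOME/k8t-c2/FINDING-19981-ass29-k8t-c2-g4.md` §1 proves (on paper) that this is EQUIVALENT to 2.9 (2) and in
particular WEAKER than local irreducibility. This file proves the latter implication in the kernel, with no
hypothesis beyond `W` elliptic:

* `fouquetGenericAt_of_locIrr`: if `W[p]` is irreducible as a `G_{ℚ_p}`-module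
  (`Additive.LocIrr W p := (W.baseChange ℚ_[p]).HasIrreducibleModPGaloisRep p`) then `ΨSq_p` has no root
  in `ℚ_p`. Proof: a root `x₀ ∈ ℚ_p` is the abscissa of a point `P = (x₀, y₀) ∈ W(ℚ̄_p)` (`ℚ̄_p`
  algebraically closed), which is `p`-torsion (`zsmul_some_eq_zero_iff_eval_ΨSq`) and non-zero; every
  `σ ∈ G_{ℚ_p}` fixes `x₀`, so `σP = ±P` (`Y_eq_of_X_eq`), and `ℤ·P ⊂ W[p]` is a `G_{ℚ_p}`-stable subgroup
  of order `p` — neither `⊥` nor `⊤` (`#W[p] = p²`, `card_torsionPoints_eq_sq_holds`), contradicting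
  irreducibility;
* `fouquetTransportShape_locIrr_of_exact`: hence the EXACT transport shape `FouquetTransportShapeExact KMC`
  (Defs §3) yields seat g3's transport on the locally irreducible rows (the Fouquet–Wan locus `LocIrr` of the
  v3 stub `stub_lower_fwLocus`), i.e. the exact shape is at least as usable there.

Nothing here is conditional; nothing is booked; the item is NOT closed (these are eligibility lemmas for
the Fouquet road, whose transport theorem itself remains a SHAPE). Seat `bsd-potss-k8t-c2`
(prover-bsd-potss-k8t-c2-g4-0).

References: [Fouquet2025EquivariantTNC] Ass. 2.9 (p. 15); [SilvermanAEC2009] III.6.4 (`E[p] ≅ (ℤ/p)²`),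
Exercise 3.7 (division polynomials); [Serre1972] §4.
-/

set_option autoImplicit false
-- sibling precedent (`KatoDescentTamePotSupersingularAssembly.lean`): the directory name repeats the summit name
set_option linter.dupNamespace false

noncomputable section

open scoped Classical

namespace Summit.BirchSwinnertonDyer.BirchSwinnertonDyer.Theorems

open WeierstrassCurve Polynomial Literature.NumberTheory.EllipticCurves
  Literature.NumberTheory.EllipticCurves.Rank1Residual
  Summit.BirchSwinnertonDyer.Rank1Residual.Additive

/-- **Local irreducibility implies Fouquet's Ass. 2.9 (2) (exact form).** For `W/ℚ` elliptic and `p`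
prime: if `W[p]` is an irreducible `G_{ℚ_p}`-module (`LocIrr W p`) then the `p`-division polynomial of
`W/ℚ_p` has no root in `ℚ_p` (`FouquetGenericAt p W`). A `ℚ_p`-rational root would be the abscissa of a
non-zero `p`-torsion point `P ∈ W(ℚ̄_p)` with `σP = ±P` for all `σ ∈ G_{ℚ_p}`, so `ℤ·P` would be a stable
subgroup of order `p` in `W[p] ≅ (ℤ/p)²`. Unconditional. [cite: SilvermanAEC2009, Cor. III.6.4 and Exercise 3.7]
[cite: Fouquet2025EquivariantTNC, Ass. 2.9 (p. 15)] -/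
theorem fouquetGenericAt_of_locIrr (W : WeierstrassCurve ℚ) [W.IsElliptic] (p : ℕ) [hp : Fact p.Prime]
    (hirr : LocIrr W p) : FouquetGenericAt p W := by
  intro x₀ hx₀
  -- notation: `V = W/ℚ_p`, `L = ℚ̄_p`, `V' = V/L`
  set V : WeierstrassCurve ℚ_[p] := W.baseChange ℚ_[p] with hV
  let L : Type := AlgebraicClosure ℚ_[p]
  let φ : ℚ_[p] →+* L := algebraMap ℚ_[p] L
  set x₁ : L := φ x₀ with hx₁
  -- `x₁` is a root of the `p`-division polynomial of `V/L`
  have hΨ : ((V.baseChange L).ΨSq (p : ℤ)).eval x₁ = 0 := by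
    have hmap : (V.baseChange L).ΨSq (p : ℤ) = (V.ΨSq (p : ℤ)).map φ := by
      rw [WeierstrassCurve.baseChange, WeierstrassCurve.map_ΨSq]
    rw [hmap, Polynomial.eval_map, hx₁, Polynomial.eval₂_hom, hx₀, map_zero]
  -- a point `P = (x₁, y₁)` of `V` over the algebraically closed field `L`
  obtain ⟨y₁, hy₁⟩ : ∃ y : L, (V.baseChange L).toAffine.Equation x₁ y := by
    set V' := V.baseChange L with hV'
    let q : L[X] := X ^ 2 + C (V'.a₁ * x₁ + V'.a₃) * X - C (x₁ ^ 3 + V'.a₂ * x₁ ^ 2 + V'.a₄ * x₁ + V'.a₆)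
    have hq : q.degree = 2 := by
      simp only [q]
      compute_degree!
    obtain ⟨y, hy⟩ := IsAlgClosed.exists_root q (by rw [hq]; norm_num)
    refine ⟨y, ?_⟩
    rw [WeierstrassCurve.Affine.equation_iff]
    have : y ^ 2 + (V'.a₁ * x₁ + V'.a₃) * y - (x₁ ^ 3 + V'.a₂ * x₁ ^ 2 + V'.a₄ * x₁ + V'.a₆) = 0 := by
      simpa [q, Polynomial.IsRoot] using hy
    linear_combination this
  have hns : (V.baseChange L).toAffine.Nonsingular x₁ y₁ :=
    (WeierstrassCurve.Affine.equation_iff_nonsingular).mp hy₁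
  set P : geomPoints V := WeierstrassCurve.Affine.Point.some x₁ y₁ hns with hP
  have hP0 : P ≠ 0 := fun h => WeierstrassCurve.Affine.Point.some_ne_zero hns h
  have hpP : (p : ℤ) • P = 0 := ((V.baseChange L).zsmul_some_eq_zero_iff_eval_ΨSq hns (p : ℤ)).mpr hΨ
  -- every `σ ∈ G_{ℚ_p}` sends `P` to `P` or `-P`
  have hσ : ∀ σ : Field.absoluteGaloisGroup ℚ_[p], σ • P = P ∨ σ • P = -P := by
    intro σ
    let τ : L ≃ₐ[ℚ_[p]] L := σ
    have hfix : (τ : L →ₐ[ℚ_[p]] L) x₁ = x₁ := by rw [hx₁]; exact (τ : L →ₐ[ℚ_[p]] L).commutes x₀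
    have hsmul : σ • P = WeierstrassCurve.Affine.Point.map (τ : L →ₐ[ℚ_[p]] L) P := rfl
    rw [hsmul, hP, WeierstrassCurve.Affine.Point.map_some]
    have heq' : (V.baseChange L).toAffine.Equation x₁ ((τ : L →ₐ[ℚ_[p]] L) y₁) := by
      have h := ((WeierstrassCurve.Affine.baseChange_nonsingular V.toAffine
        (f := (τ : L →ₐ[ℚ_[p]] L)) (τ : L →ₐ[ℚ_[p]] L).injective x₁ y₁).mpr hns).left
      rwa [hfix] at h
    rcases WeierstrassCurve.Affine.Y_eq_of_X_eq heq' hy₁ rfl with h1 | h2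
    · left
      change (WeierstrassCurve.Affine.Point.some _ _ _ : (V.baseChange L).toAffine.Point) =
        WeierstrassCurve.Affine.Point.some x₁ y₁ hns
      simp only [WeierstrassCurve.Affine.Point.some.injEq]
      exact ⟨hfix, h1⟩
    · right
      change (WeierstrassCurve.Affine.Point.some _ _ _ : (V.baseChange L).toAffine.Point) =
        -WeierstrassCurve.Affine.Point.some x₁ y₁ hns
      rw [WeierstrassCurve.Affine.Point.neg_some]
      simp only [WeierstrassCurve.Affine.Point.some.injEq]
      exact ⟨hfix, h2⟩
  -- the stable subgroup `ℤ·P ⊂ V[p]`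
  have hPt : P ∈ geomTorsion V (p : ℤ) := by
    change P ∈ AddSubgroup.torsionBy (geomPoints V) (p : ℤ)
    exact (Submodule.mem_torsionBy_iff (p : ℤ) P).mpr hpP
  set Pt : geomTorsion V (p : ℤ) := ⟨P, hPt⟩ with hPtdef
  set H : AddSubgroup (geomTorsion V (p : ℤ)) := AddSubgroup.zmultiples Pt with hH
  have hstab : ∀ σ : Field.absoluteGaloisGroup ℚ_[p], ∀ Q ∈ H, σ • Q ∈ H := by
    intro σ Q hQ
    obtain ⟨k, rfl⟩ := AddSubgroup.mem_zmultiples_iff.mp hQ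
    have hcomm : σ • (k • Pt) = k • (σ • Pt) := map_zsmul (DistribSMul.toAddMonoidHom _ σ) k Pt
    rw [hcomm]
    have hσPt : σ • Pt = Pt ∨ σ • Pt = -Pt := by
      rcases hσ σ with h | h
      · left; exact Subtype.ext (by rw [AddSubgroup.torsionBy.coe_smul]; exact h)
      · right; exact Subtype.ext (by rw [AddSubgroup.torsionBy.coe_smul]; exact h)
    rcases hσPt with h | h
    · rw [h]; exact AddSubgroup.zsmul_mem _ (AddSubgroup.mem_zmultiples Pt) k
    · rw [h, zsmul_neg]
      exact H.neg_mem (AddSubgroup.zsmul_mem _ (AddSubgroup.mem_zmultiples Pt) k)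
  -- it is neither `⊥` nor `⊤`
  rcases hirr H hstab with hbot | htop
  · have hmem : Pt ∈ H := AddSubgroup.mem_zmultiples Pt
    rw [hbot, AddSubgroup.mem_bot] at hmem
    exact hP0 (congrArg Subtype.val hmem)
  · -- `#H = ord(P) ≤ p < p² = #V[p]`
    have hpL : ((p : ℕ) : L) ≠ 0 := by exact_mod_cast hp.out.ne_zero
    have hcardT : Nat.card (geomTorsion V (p : ℤ)) = p ^ 2 :=
      WeierstrassCurve.card_torsionPoints_eq_sq_holds V L (n := p) hpL
    have hcardH : Nat.card H = addOrderOf Pt := by rw [hH, Nat.card_zmultiples]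
    have hord : addOrderOf Pt ∣ p := by
      apply addOrderOf_dvd_of_nsmul_eq_zero
      apply Subtype.ext
      change ((p : ℕ) • Pt : geomTorsion V (p : ℤ)).val = 0
      rw [AddSubgroup.coe_nsmul]
      change (p : ℕ) • P = 0
      rw [← natCast_zsmul]
      exact hpP
    have hle : Nat.card H ≤ p := by
      rw [hcardH]; exact Nat.le_of_dvd hp.out.pos hord
    have htop' : Nat.card H = Nat.card (geomTorsion V (p : ℤ)) := by
      rw [htop]; exact AddSubgroup.card_top
    rw [htop', hcardT] at hle
    have h1 : p < p ^ 2 := by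
      have := hp.out.one_lt
      nlinarith
    omega

/-- **The exact transport shape serves the locally irreducible rows.** Seat g3's Fouquet transport on
the Fouquet–Wan locus (`LocIrr`, the first disjunct of `FouquetTransportShape`'s local clause) follows from
the EXACT shape `FouquetTransportShapeExact KMC` (Defs §3), by `fouquetGenericAt_of_locIrr`. Bookkeeping
over the shape (consumed as a hypothesis); nothing credited.
[cite: Fouquet2025EquivariantTNC, Thm 4.1 (pp. 24–25) and Ass. 2.9 (p. 15)] -/
theorem fouquetTransportShape_locIrr_of_exact
    {KMC : ∀ (W : WeierstrassCurve ℚ) [W.IsElliptic] [W.IsGloballyMinimal] (p : ℕ), Prop}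
    (hF : FouquetTransportShapeExact KMC) :
    ∀ (W G : WeierstrassCurve ℚ) [W.IsElliptic] [W.IsGloballyMinimal] [G.IsElliptic] [G.IsGloballyMinimal]
      (p : ℕ) [Fact p.Prime], 5 ≤ p → ClassX4 W p → Surj W p → LocIrr W p → FouquetEligibleAt p W →
      IsCongruentModP p W G → FouquetLevelCompatibleAt p W G → KMC G p → KMC W p :=
  fun W G _ _ _ _ p _ hp hX hsurj hirr helig hcong hlev hG =>
    hF W G p hp hX hsurj (fouquetGenericAt_of_locIrr W p hirr) helig hcong hlev hG

end Summit.BirchSwinnertonDyer.BirchSwinnertonDyer.Theorems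

end
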